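import Literature.Computability.AlgebraicComplexity.MS2001ClassVarieties
import HarnessLib

/-!
# Weight degenerations lie in the orbit closure: `Δ[g]` is a `GL`-stable cone and contains the
# initial forms `in_w(g) = lim_{t→0} t^{-W₀} (α_w(t) · g)` (GCT I §4.2's device, general form)

Topic `Computability/AlgebraicComplexity`. K. Mulmuley, M. Sohoni, *Geometric complexity theory
I*, SIAM J. Comput. 31 (2001) 496–526 [bib `MulmuleySohoniSIAM2001`], §4.2 (AV pp.17–18,
all.txt L1226–1262; text of record `run/shared/lean/pub/val-lit/bip/texts/MS2001-authorversion/`):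
the Tutte-matrix device "`D(Y) = det(α(t)Y) = t^{2W} h(Y) +` higher order terms … since
`h(Y) = lim_{t→0} t^{-2W} D(Y)` in the projective space `P(V)`, … `h(Y)` belongs to the projective
closure `Δ[det(Y)]`". This file proves the device for an ARBITRARY form `g` and an arbitrary
one-parameter subgroup `α_w(t) = diag(t^{w_i})` of the torus (companions:
`MS2001ClassVarieties.lean` §3, the `lim_{t→0}` lemma `coeffVec_map_eval_zero_mem_zariskiClosure_of_family`;
`MS2001DetInitialForms.lean`, the determinant case with the scalar absorbed by a row rescaling).
Theorems only: no definitions, no facts, no `sorry`.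

## Contents (every infinite field `k`; `g` a form of degree `D ≥ 1`)

* `linSubst_smul_one_of_isHomogeneous'` — scalar matrices act on forms of degree `D` by `c^D`.
* `linSubst_mem_orbitClosure_of_mem` — `Δ[g]` is stable under every substitution `A ∈ End`.
* **`smul_mem_orbitClosure`** — `Δ[g]` is a CONE: `c • h ∈ Δ[g]` for `h ∈ Δ[g]` and every
  scalar `c` (the affine counterpart of the print's passage to `P(V)`): the polynomial
  `λ ↦ p(λ • h)` vanishes at every `D`-th power `λ = μ^D` (as `μ^D • h = (μ·1) · h ∈ Δ[g]`), an
  infinite set, hence identically.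
* **`weightedHomogeneousComponent_mem_orbitClosure`** — for weights `w : σ → ℕ` and `W₀` not
  exceeding the `w`-weight of any monomial of `g`, the weight-`W₀` part
  `in_{w,W₀}(g) = ∑_{wt_w(d) = W₀} g_d Y^d` (Mathlib's `weightedHomogeneousComponent w W₀ g`) lies
  in `Δ[g]`: it is the value at `t = 0` of the polynomial family `t^{-W₀} • (α_w(t) · g)`, whose
  values at `t ≠ 0` lie in the cone `Δ[g]`.

Honest framing: literature typing of a standard device (toric/weight degenerations); nothing here
bears on any separation (`VP ≠ VNP` NOT proved).

## References

* [MulmuleySohoniSIAM2001] K. Mulmuley, M. Sohoni, *Geometric complexity theory I*, SIAM J.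
  Comput. 31 (2001) 496–526, §4.2 (AV pp.17–18, all.txt L1226–1262).
-/

noncomputable section

open MvPolynomial

namespace Literature.Computability.AlgebraicComplexity

universe u v

variable {k : Type u} [Field k] {σ : Type v} [Fintype σ] [DecidableEq σ]

/-! ## §1. Scalars and substitutions on `Δ[g]` -/

omit [Fintype σ] [DecidableEq σ] in
/-- Forms of degree `m` are eigenvectors of the scalar substitution `X_i ↦ c X_i`, eigenvalue
`c^m` (the tree's `aeval_smul_X_of_isHomogeneous`, over any field). [folklore] -/
private theorem aeval_smul_X_of_isHomogeneous' {f : MvPolynomial σ k} {m : ℕ}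
    (hf : f.IsHomogeneous m) (c : k) :
    aeval (fun i => c • (X i : MvPolynomial σ k)) f = c ^ m • f := by
  conv_lhs => rw [f.as_sum]
  conv_rhs => rw [f.as_sum]
  rw [map_sum, Finset.smul_sum]
  refine Finset.sum_congr rfl fun d hd => ?_
  have hdeg : d.degree = m := by
    have := hf (mem_support_iff.mp hd)
    rw [Finsupp.degree_eq_weight_one]
    exact this
  rw [aeval_monomial, monomial_eq, Algebra.algebraMap_eq_smul_one, smul_mul_assoc, one_mul,
    smul_eq_C_mul, smul_eq_C_mul, ← mul_assoc, ← map_mul, mul_comm (c ^ m)]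
  rw [map_mul, mul_assoc]
  congr 1
  rw [Finsupp.prod, Finsupp.prod]
  have : ∀ i ∈ d.support, (c • (X i : MvPolynomial σ k)) ^ d i = C (c ^ d i) * X i ^ d i := by
    intro i _
    rw [smul_eq_C_mul, mul_pow, ← map_pow]
  rw [Finset.prod_congr rfl this, Finset.prod_mul_distrib, ← map_prod, Finset.prod_pow_eq_pow_sum,
    ← Finsupp.degree_apply, hdeg]

/-- **Scalar matrices act on forms of degree `m` by `c^m`**: `(c · 1) · f = c^m • f`.
[cite: MulmuleySohoniSIAM2001, §4.2 (AV p.18, all.txt L1249–1256: "in the projective space")] -/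
theorem linSubst_smul_one_of_isHomogeneous' {f : MvPolynomial σ k} {m : ℕ}
    (hf : f.IsHomogeneous m) (c : k) :
    linSubst σ k (c • (1 : Matrix σ σ k)) f = c ^ m • f := by
  unfold linSubst
  have : (fun i : σ => ∑ j, (c • (1 : Matrix σ σ k)) j i • (X j : MvPolynomial σ k)) =
      fun i => c • X i := by
    funext i
    simp only [Matrix.smul_apply, Matrix.one_apply, smul_eq_mul, mul_ite, mul_one, mul_zero,
      ite_smul, zero_smul]
    rw [Finset.sum_ite_eq' Finset.univ i, if_pos (Finset.mem_univ _)]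
  rw [this]
  exact aeval_smul_X_of_isHomogeneous' hf c

/-- **`Δ[g]` is stable under all substitutions**: `A · h ∈ Δ[g]` for `h ∈ Δ[g]` and every
square matrix `A` (`End · h ⊆ Δ[h] ⊆ Δ[g]`, tree `orbitClosure_subset_of_mem_holds`).
[cite: MulmuleySohoniSIAM2001, §4.2 (AV p.18, all.txt L1249–1251)] -/
theorem linSubst_mem_orbitClosure_of_mem [Infinite k] {g h : MvPolynomial σ k}
    (hh : h ∈ orbitClosure g) (A : Matrix σ σ k) : linSubst σ k A h ∈ orbitClosure g :=
  orbitClosure_subset_of_mem_holds hh (endOrbit_subset_orbitClosure_holds h ⟨A, rfl⟩)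

/-- Over an infinite field the `D`-th powers of the nonzero scalars form an infinite set
(`D ≥ 1`: each fibre of `μ ↦ μ^D` is finite). [folklore] -/
private theorem infinite_setOf_pow [Infinite k] {D : ℕ} (hD : 0 < D) :
    Set.Infinite {x : k | ∃ μ : k, μ ≠ 0 ∧ μ ^ D = x} := by
  intro hfin
  have hfib : ∀ x : k, Set.Finite {μ : k | μ ^ D = x} := fun x =>
    (Multiset.finite_toSet (Polynomial.nthRoots D x)).subset fun μ (hμ : μ ^ D = x) => by
      show μ ∈ Polynomial.nthRoots D x
      exact (Polynomial.mem_nthRoots hD).2 hμ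
  have hne : Set.Finite {μ : k | μ ≠ 0} := by
    refine (hfin.biUnion fun x _ => hfib x).subset fun μ (hμ : μ ≠ 0) => ?_
    rw [Set.mem_iUnion₂]
    refine ⟨μ ^ D, ?_, ?_⟩
    · exact ⟨μ, hμ, rfl⟩
    · show μ ^ D = μ ^ D
      rfl
  have huniv : Set.Finite (Set.univ : Set k) :=
    ((Set.finite_singleton (0 : k)).union hne).subset fun μ _ => by
      by_cases h : μ = 0
      · exact Or.inl h
      · exact Or.inr h
  exact Set.infinite_univ huniv

/-- **`Δ[g]` is a cone** (the affine shadow of "in the projective space `P(V)`", AV p.18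
L1249–1256): for a form `g` of degree `D ≥ 1` over an infinite field, `c • h ∈ Δ[g]` for every
`h ∈ Δ[g]` and every scalar `c`. (For `c = μ^D` this is the substitution `μ · 1`; the univariate
polynomial `λ ↦ p(λ • h)` for `p` vanishing on `GL · g` vanishes at all `D`-th powers, an
infinite set, hence everywhere.) [cite: MulmuleySohoniSIAM2001, §4.2 (AV p.18, all.txt L1249–1256)] -/
theorem smul_mem_orbitClosure [Infinite k] {g h : MvPolynomial σ k} {D : ℕ}
    (hg : g.IsHomogeneous D) (hD : 0 < D) (hh : h ∈ orbitClosure g) (c : k) :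
    c • h ∈ orbitClosure g := by
  classical
  have hhD : h.IsHomogeneous D := hg.of_mem_orbitClosure hh
  rw [mem_orbitClosure_iff]
  intro p hp
  -- the univariate polynomial `λ ↦ p(coeffVec (λ • h))`
  set q : Polynomial k :=
    MvPolynomial.aeval (fun d : σ →₀ ℕ => Polynomial.C (coeff d h) * Polynomial.X) p with hq
  have hqeval : ∀ l : k, q.eval l = MvPolynomial.aeval (coeffVec (l • h)) p := by
    intro l
    have hfun : (fun d : σ →₀ ℕ =>
        Polynomial.aeval l (Polynomial.C (coeff d h) * Polynomial.X)) = coeffVec (l • h) := by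
      funext d
      rw [map_mul, Polynomial.aeval_C, Polynomial.aeval_X, Algebra.algebraMap_self_apply,
        coeffVec_apply, coeff_smul, smul_eq_mul, mul_comm]
    rw [hq, ← Polynomial.coe_aeval_eq_eval, ← AlgHom.comp_apply, MvPolynomial.comp_aeval, hfun]
  have hroot : ∀ μ : k, μ ≠ 0 → q.IsRoot (μ ^ D) := by
    intro μ _
    rw [Polynomial.IsRoot, hqeval]
    have hmem : μ ^ D • h ∈ orbitClosure g := by
      rw [← linSubst_smul_one_of_isHomogeneous' hhD μ]
      exact linSubst_mem_orbitClosure_of_mem hh _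
    exact (mem_orbitClosure_iff.1 hmem) p hp
  have hq0 : q = 0 := by
    refine Polynomial.eq_zero_of_infinite_isRoot q ((infinite_setOf_pow (k := k) hD).mono ?_)
    rintro x ⟨μ, hμ, hx⟩
    rw [Set.mem_setOf_eq, ← hx]
    exact hroot μ hμ
  have := hqeval c
  rw [hq0, Polynomial.eval_zero] at this
  exact this.symm

/-! ## §2. Weight degenerations -/

/-- A diagonal substitution scales each variable. [folklore] -/
private theorem linSubst_diagonal_X'' (d : σ → k) (v : σ) :
    linSubst σ k (Matrix.diagonal d) (X v) = d v • X v := by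
  rw [linSubst_X, Finset.sum_eq_single v (fun j _ hjv => by
    rw [Matrix.diagonal_apply_ne _ hjv, zero_smul]) (fun h => absurd (Finset.mem_univ v) h),
    Matrix.diagonal_apply_eq]

/-- The one-parameter subgroup `α_w(t) = diag(t^{w_i})` multiplies the monomial `Y^d` by
`t^{wt_w(d)}`, `wt_w(d) = ∑_i d_i w_i`. [cite: MulmuleySohoniSIAM2001, §4.2 (AV p.17, all.txt L1226–1241)] -/
theorem linSubst_diagonal_pow_monomial (w : σ → ℕ) (t : k) (d : σ →₀ ℕ) (a : k) :
    linSubst σ k (Matrix.diagonal fun i => t ^ w i) (monomial d a) =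
      t ^ Finsupp.weight w d • monomial d a := by
  have hC : linSubst σ k (Matrix.diagonal fun i => t ^ w i) (C a) = C a := AlgHom.commutes _ a
  rw [monomial_eq, map_mul, hC, smul_eq_C_mul, ← mul_assoc,
    mul_comm (C (t ^ Finsupp.weight w d)) (C a), mul_assoc]
  congr 1
  rw [Finsupp.prod, map_prod, Finsupp.weight_apply, Finsupp.sum, ← Finset.prod_pow_eq_pow_sum,
    map_prod, ← Finset.prod_mul_distrib]
  refine Finset.prod_congr rfl fun i _ => ?_
  rw [map_pow, linSubst_diagonal_X'', smul_eq_C_mul, mul_pow, ← map_pow, ← pow_mul, smul_eq_mul,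
    mul_comm (w i) (d i)]

/-- **Weight degenerations lie in the orbit closure** (the device of GCT I §4.2, AV pp.17–18
L1226–1262, for an arbitrary form): let `g` be a form of degree `D ≥ 1` over an infinite field,
`w : σ → ℕ` integer weights and `W₀` a weight not exceeding the `w`-weight of any monomial of
`g`. Then the weight-`W₀` part `in_{w,W₀}(g) = ∑_{wt_w(d) = W₀} g_d Y^d`
(`weightedHomogeneousComponent w W₀ g`; the print's `h(Y) = lim_{t→0} t^{-W₀} (α_w(t) · g)`)
lies in `Δ[g]`. Proof as printed: the family `t^{-W₀} • (α_w(t) · g)` is polynomial in `t`,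
its values at `t ≠ 0` lie in the cone `Δ[g]` (`smul_mem_orbitClosure`,
`linSubst_mem_orbitClosure_of_mem`), and its value at `t = 0` is `in_{w,W₀}(g)`
(`coeffVec_map_eval_zero_mem_zariskiClosure_of_family`).
[cite: MulmuleySohoniSIAM2001, §4.2 (AV p.18, all.txt L1249–1262)] -/
theorem weightedHomogeneousComponent_mem_orbitClosure [Infinite k] {g : MvPolynomial σ k}
    {D : ℕ} (hg : g.IsHomogeneous D) (hD : 0 < D) (w : σ → ℕ) {W₀ : ℕ}
    (hmin : ∀ d ∈ g.support, W₀ ≤ Finsupp.weight w d) :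
    weightedHomogeneousComponent w W₀ g ∈ orbitClosure g := by
  classical
  -- the family `F(t) = ∑_d t^{wt d - W₀} g_d Y^d`
  set F : MvPolynomial σ (Polynomial k) :=
    ∑ d ∈ g.support, C (Polynomial.X ^ (Finsupp.weight w d - W₀)) *
      monomial d (Polynomial.C (coeff d g)) with hF
  have hFt : ∀ t : k, MvPolynomial.map (Polynomial.evalRingHom t) F =
      ∑ d ∈ g.support, C (t ^ (Finsupp.weight w d - W₀)) * monomial d (coeff d g) := by
    intro t
    rw [hF, map_sum]
    refine Finset.sum_congr rfl fun d _ => ?_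
    rw [map_mul, map_C, map_monomial, Polynomial.coe_evalRingHom, Polynomial.eval_pow,
      Polynomial.eval_X, Polynomial.eval_C]
  -- value at `t = 0`
  have h0 : MvPolynomial.map (Polynomial.evalRingHom 0) F = weightedHomogeneousComponent w W₀ g := by
    rw [hFt, weightedHomogeneousComponent_apply, Finset.sum_filter]
    refine Finset.sum_congr rfl fun d hd => ?_
    by_cases hW : Finsupp.weight w d = W₀
    · rw [if_pos hW, hW, Nat.sub_self, pow_zero, C_1, one_mul]
    · have hne : Finsupp.weight w d - W₀ ≠ 0 := by
        have := hmin d hd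
        omega
      rw [if_neg hW, zero_pow hne, C_0, zero_mul]
  -- values at `t ≠ 0`: `t^{-W₀} • (α_w(t) · g) ∈ Δ[g]`
  have hmem : ∀ t : k, t ≠ 0 →
      MvPolynomial.map (Polynomial.evalRingHom t) F ∈ orbitClosure g := by
    intro t ht
    have heq : MvPolynomial.map (Polynomial.evalRingHom t) F =
        (t ^ W₀)⁻¹ • linSubst σ k (Matrix.diagonal fun i => t ^ w i) g := by
      rw [hFt]
      conv_rhs => rw [g.as_sum, map_sum, Finset.smul_sum]
      refine Finset.sum_congr rfl fun d hd => ?_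
      rw [linSubst_diagonal_pow_monomial, smul_smul, ← smul_eq_C_mul,
        pow_sub₀ _ ht (hmin d hd), mul_comm]
    rw [heq]
    exact smul_mem_orbitClosure hg hD (linSubst_mem_orbitClosure_of_mem (mem_orbitClosure_self g) _) _
  -- the limit
  rw [← h0]
  have hz := coeffVec_map_eval_zero_mem_zariskiClosure_of_family (orbitClosure g) F hmem
  have hsub : coeffVec '' orbitClosure g ⊆ zariskiClosure (coeffVec '' glOrbit σ k g) := by
    rintro _ ⟨h, hh, rfl⟩
    exact hh
  have := zariskiClosure_mono hsub hz
  rw [zariskiClosure_zariskiClosure] at this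
  exact this

end Literature.Computability.AlgebraicComplexity
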